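import Mathlib
import HarnessLib
import Summits.HodgeConjecture.HodgeConjecture.Theorems.NikulinTwinTransportTwinTwistorTransportMukaiLiftDefs
import Literature.AlgebraicGeometry.Hyperkaehler.K3HilbertSchemeBeauvilleFujiki
import Literature.AlgebraicGeometry.ModuliOfSheaves.HilbertSchemeOfPoints
import Literature.AlgebraicGeometry.Surfaces.PolarisedK3TwinKuranishiFamily

/-!
# Crux `NikulinTwinTransport.TwinTwistorTransport` (stmt-HodgeConjecture-14393), line
# `mukai-lift-full-similitude`: the stub `HilbertPackage` from the named Hilbert-scheme facts (glue)

Registered sub-goal `HilbertPackage_of_facts` of the checked skeleton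
`Cruxes/TwinTwistorTransport/Lines/mukai_lift_full_similitude.lean` (lead c3, wave 2): the registered
statement of the stub `HilbertPackage` — for every `n ≥ 2` a reference `2n`-fold `Xr` such that every
marked projective K3 surface `(S, η, p, x)` has a marked numerically-`K3^{[n]}` projective irreducible
symplectic `2n`-fold `(X, θ, pX)` of period `(x, 0)` (`MarkedHK`), deformation equivalent to `Xr`,
with Hilbert-type links `IsHilbLink n μ S X …` for every orientation family `μ` with Poincaré duality —
follows VERBATIM from four named Literature facts about the Hilbert scheme of points `X = S^{[n]}`:

* `Grothendieck_hilbertSchemeOfPoints_exists` (Göttsche Thm. 1.1.2: `(S^{[n]}, Ξ_n)` exists, `S^{[n]}`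
  projective) and `Beauville1983_hilbertScheme_K3` (Beauville 1983 §6 (b), Théorème 3: `S^{[n]}` is
  projective irreducible symplectic of dimension `2n`), file `Hyperkaehler/K3HilbertSchemeBeauville`;
* `Beauville1983_hilbertScheme_K3_markedLinks` (Beauville 1983 §6 Prop. 6 + Remarque, §9 Lemme 1 +
  Remarque 1, Fujiki's relation with constant `(2n−1)!!`, the incidence correspondence `i = [Ξ_n]_*`,
  `δ` and `ζ ∝ δ^{2n−1}` algebraic, the transposed polarised link `ρ`) and
  `Beauville1983_hilbertScheme_K3_deformationEquivalent` (all `S^{[n]}`, `S` projective K3, are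
  deformation equivalent), file `Hyperkaehler/K3HilbertSchemeBeauvilleFujiki`.

Proof: take `Xr := S₀^{[n]}` for some projective K3 surface `S₀` if one exists (otherwise the statement
is vacuous and `Xr := Spec ℂ` serves), and `X := S^{[n]}`; the clauses of `MarkedHK` and `IsHilbLink`
are those of the facts, the inlined Literature spelling of the correspondence action, of
`LiftLat = Λ_ℂ ⊕ ℂδ`, `ofZL` and `liftForm n` unfolding definitionally to the line's vocabulary
(`Theorems/…MukaiLiftDefs`).
-/

-- `Summit.HodgeConjecture.HodgeConjecture.…` (summit = problem) duplicates a namespace component by design (D-0017).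
set_option linter.dupNamespace false
set_option autoImplicit false

noncomputable section

namespace Summit.HodgeConjecture.HodgeConjecture.Theorems.TwinTwistorTransport.MukaiLift

open CategoryTheory MonoidalCategory
open scoped Manifold BigOperators
open Literature.AlgebraicGeometry.Motives Literature.AlgebraicGeometry.HodgeTheory
open Literature.AlgebraicGeometry.Surfaces Literature.AlgebraicGeometry.Hyperkaehler
open Literature.AlgebraicTopology.SingularHomology
open Literature.Geometry.Kaehler

/-- **Registered sub-goal `HilbertPackage_of_facts`: the stub `HilbertPackage` from the four named
Hilbert-scheme facts** (glue). For `n ≥ 2`: with `Xr := S₀^{[n]}` (`S₀` any projective K3 surface,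
`Grothendieck_hilbertSchemeOfPoints_exists`), every marked projective K3 `(S, η, p, x)` has
`X := S^{[n]}`, projective irreducible symplectic of dimension `2n` (`Beauville1983_hilbertScheme_K3`),
marked by `(θ, pX)` with period `(x, 0)` and the Fujiki relation, deformation equivalent to `Xr`
(`Beauville1983_hilbertScheme_K3_deformationEquivalent`), and Hilbert-linked to `S` for every
orientation family with Poincaré duality (`Beauville1983_hilbertScheme_K3_markedLinks`).
[cite: Beauville1983, §6 Prop. 6 and Remarque, Théorème 3, §9 Lemme 1 and Remarque 1] -/
theorem HilbertPackage_of_facts : Grothendieck_hilbertSchemeOfPoints_exists.{0} → Beauville1983_hilbertScheme_K3 → Beauville1983_hilbertScheme_K3_markedLinks → Beauville1983_hilbertScheme_K3_deformationEquivalent → ∀ n : ℕ, 2 ≤ n → ∃ Xr : SchemeOver ℂ, ∀ (S : SchemeOver ℂ) (hS : IsK3Surface S) (η : complexBetti S (2 * 1) ≃ₗ[ℂ] (K3Index → ℂ)) (p : complexBetti S (2 * 2)) (x : K3Index → ℂ), IsMarkedK3 S η p x → ∃ (X : SchemeOver ℂ) (θ : complexBetti X (2 * 1) ≃ₗ[ℂ]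 LiftLat) (pX : complexBetti X (2 * (2 * n))) (hX : MarkedHK n X θ pX (x, 0)), AreDeformationEquivalent (2 * n) X Xr ∧ ∀ (μ : OrientationFamily), μ.HasPoincareDuality → ∃ (ι : complexBetti (X ⊗ S) (2 * 2)) (ρ : complexBetti (S ⊗ X) (2 * (2 * n))) (c : ℂ), IsHilbLink n μ S X (IsK3Surface.isSmoothProjective hS) hX.1.1 η θ pX ι ρ c := by
  intro hG hB hAB hC n hn
  classical
  by_cases hex : ∃ S₀ : SchemeOver ℂ, IsK3Surface S₀
  · obtain ⟨S₀, hS₀⟩ := hex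
    obtain ⟨H₀, Ξ₀, hH₀, -⟩ := hG ℂ n S₀ (IsK3Surface.isSmoothProjective hS₀).isProjectiveOver
    refine ⟨H₀, ?_⟩
    intro S hS η p x hm
    obtain ⟨H, Ξ, hH, -⟩ := hG ℂ n S (IsK3Surface.isSmoothProjective hS).isProjectiveOver
    have hIHS : IsProjectiveIrreducibleSymplectic (2 * n) H := (hB n hn S H Ξ hS hH).1
    obtain ⟨θ, pX, h2, h3, h4, h5, h6, hδ, ⟨m, hm', ζ, hζ, hζb⟩, hlinks⟩ :=
      hAB n hn S hS η p x hm H Ξ hH hIHS.1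
    refine ⟨H, θ, pX, ⟨hIHS, h2, h3, h4, h5, h6⟩, hC n hn S S₀ H H₀ Ξ Ξ₀ hS hS₀ hH hH₀, ?_⟩
    intro μ hμ
    obtain ⟨⟨ι, hι, hιa⟩, ⟨ρ, hρ, c, hc, hρb⟩⟩ := hlinks μ hμ
    exact ⟨ι, ρ, c, hι, hρ, hc, hιa, hρb, hδ, m, hm', ζ, hζ, hζb⟩
  · refine ⟨specOver ℂ ℂ, ?_⟩
    intro S hS
    exact absurd ⟨S, hS⟩ hex

end Summit.HodgeConjecture.HodgeConjecture.Theorems.TwinTwistorTransport.MukaiLift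

end
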